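import Literature.MathematicalPhysics.QuantumFieldTheory.Balaban1983to89.Node00.Record12BgRowCoClassGaugeRGuardedBRow
import Literature.MathematicalPhysics.QuantumFieldTheory.Balaban1983to89.Node00.Record13CoP
import Summits.QuantumFields.YangMills.Theorems.BalabanUVNodesN11BgRowOfPowM

/-!
# DAG node N11 × K1 — THE powM EDITIONS OF THE GUARD-FREE LIFT: row P11's analytic body, its `(Adm, bd, Dat)`-generic ᴮ form and the BACKGROUND-GENERIC Stage-13 lift with the (1.12)-cube
# inclusion `hcubeΩ` DISCHARGED at a power-of-`L` basic cube (`0 < M`, `M = L^a`, the (C1) letter — dag-n11-w4's `hcubeΩ_of_powM`) — the green home of the lift under director-ym №365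
# (RENAME-AND-REDIRECT), importing NO residue module

HEADER — WORK-UNIT METADATA.  Cell `pub-ymgap`, YM-PLAN Track A (D-0062 ∕ D-0149 ∕ D-0154 width seats), seat `pub-ymgap-dag-n11-w1` (g6; WIDTH SEAT 1 on NODE n11 [B14]; Stage-2 train;
director-ym №365 = gate8's R558 answer «RENAME-AND-REDIRECT: new sibling modules, old CLASS-T modules untouched = residue»; dag-lead №366 pointer: a PUBLIC byte-for-byte copy of a landed
decl bounces `dedup.landed` — this seat's verbatim-copy sibling `…GaugeROfHcubeOmegaB` (INTENT-3 8b352b583a850b2d) dry-ran BOUNCED `dedup.landed` 10:05Z and is WITHDRAWN in favour of THIS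
genuinely different public form), route `BalabanUVNodes`, key `--kind proof --supports stmt-QuantumFields-20541 --as helper` (K0⁷ helper lane, count-neutral).  CONTENT PROVENANCE: the three
proofs are dag-n11-w5 g2's §1 and dag-n11-d g41's v1.1 §7.1 ∕ §7.3 of `…N11BgRowGaugeROfHcubeOmega` (✓p767169) with the run-indexed cube-inclusion hypothesis `hcube` REPLACED by its powM supplier
— one `have hcube := hcubeΩ_of_powM …` line each; everything else verbatim.  Over k0-s1-w1's breaker-free `Node00/Record12BgRowCoClassGaugeRGuardedBRow` (S1a-C ∕ S1b-2's ᴮ sentences +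
B′'s row-body API), def-R's `Node00/Record13CoP` (Stage-13 record API) and dag-n11-w4's `…N11BgRowOfPowM` (★ `hcubeΩ_of_powM`).  [III] = [Balaban1988Convergent], [I] = [Balaban1987RG1],
[15] = [Balaban1985Variational], [6] = [Balaban1985RegularSpaces], [II] = [Balaban1984PropagatorsII].

WHY THIS FILE.  `…N11BgRowGaugeROfHcubeOmega` carries, in ONE module, the seam-invariant lift §7.3 that every module of the guard-free row-P11 chain reads (this seat's `…SocketsGB` ✓p767538 ∕
`…SocketsGBPrint` ✓p767961 and their siblings-to-be, dag-n11-w3's member ∕ door files — 18 importers) AND two CLASS-T declarations (§5∕§6) whose text stops elaborating at node00-def-R's seam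
edit; under №365 that module becomes RESIDUE and a residue import reddens the chain.  Every consumer on the chain reads the lift ONLY in its powM form (`hcube := hcubeΩ_of_powM …` — see
`…SocketsGB` §1a's proof), so the powM editions below ARE the interface of record; `…SocketsGB` v1.1 re-points to §3 by an import + proof-term edition with all statements byte-identical (CLASS S).

WHAT THIS FILE PROVES (3 theorems, 0 `def`, 0 `sorry`; hypothesis threading; the ᴮ sentences are named facts, never asserted).
§1 ★★ `bgRowAtDatumU_of_classBoundsPos_of_localGauge_of_powM` — row P11's analytic body for an arbitrary background from per-scale class bounds and handed-over local gauges at a power-of-`L`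
   cube with the (C1) letter (B′'s `Record12BgRowCoClassGauge` :291 road; the torus read through `hcubeΩ_of_powM` and `hsN` only).
§2 ★★ `bgRowAtDatumU_of_thm1RegSepTop7MGB_of_thm1GaugeGB_of_powM` — the `(Adm, bd, Dat)`-generic ᴮ row body for every `bd`-minimiser over the top-domain class (6) (S1a-C ∕ S1b-2 letters), powM form.
§3 ★★★ `stage13_bgAtDatumBg_of_thm1RegSepCoP7MGB_of_thm1GaugeGB_of_powM` — the background-generic Stage-13 lift (`Ubg` a parameter with its per-prefix `bd`-spec dichotomy `hbg`), NO run guard,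
   at `θ.τ9.M = F.L ^ a` with the window-run-indexed (C1) letter: the `hcube`-free form `…SocketsGB` §1a instantiates.

HONEST FRAMING.  Helper lane; count-neutral hypothesis threading over landed theorems; the ᴮ [15] sentences (8) `VariationalThm1RegSepTop7MGB ∕ …CoP7MGB` and (9) `VariationalThm1GaugeRegSepTop7MGB
∕ …CoP7MGB` are `Prop`s with parameters, NEVER asserted; `hbg`, `hadm`, the numeric rows, `hsN`, `hMa`, `hC1` DISPLAYED.  Nothing in the tree is edited.  NOT a discharge of row P11; N11 ∕ N07
NOT discharged; K0⁷ stub 1 NOT closed; counts unmoved (typed 28∕28 · discharged 8∕27).  R4 closes only the conditional finite-𝕋⁴ rung `BalabanLadder.UV` at fixed `ε = L^{−K}` — NOT ℝ⁴, NOT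
OS, NOT a mass gap; the Yang–Mills mass gap (Clay) is NOT proved by any of this.  No `sorry`, `axiom`, `def`, `instance`, `notation`.
Sources (SHAPE ∕ bookkeeping only): [III] (2.1) p.254, (2.4)–(2.8) pp.255–256, (2.12)–(2.13) pp.256–257, (2.27)–(2.28) p.259, (2.34)–(2.41) p.261, Thm 1 p.262, p.257; [I] (0.1) p.251,
(1.11)–(1.16) p.262; [15] (6)–(7) p.278, Thm 1 (8)–(9) p.279, Prop. 8 p.304; [6] (1.3)–(1.9) p.77; [II] (2.3) p.224.
-/

noncomputable section

open MeasureTheory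
open scoped Matrix.Norms.L2Operator

namespace Summit.QuantumFields.YangMills.Theorems.BalabanUVNodesN11BgRowGaugeLiftOfPowM

open Literature.MathematicalPhysics.QuantumFieldTheory.Balaban1983to89 Node00
open T4Continuum B14.Eq218Concrete B15DeterminingSets B15DeterminingSetsB FlowStep FlowStepRuns B12RegularSpaces111 B14RegularSpaces234 B14Radii T4AxialGaugeSmallField
open BalabanUVNodesN11BgRowOfPowM (hcubeΩ_of_powM)

variable {F : T4Family} {N : ℕ} [NeZero N]

/-- **§1 ★★ ROW P11's ANALYTIC BODY FOR AN ARBITRARY BACKGROUND `U` FROM PER-SCALE CLASS BOUNDS AND HANDED-OVER LOCAL GAUGES, AT A POWER-OF-`L` BASIC CUBE WITH THE (C1) LETTER**: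
dag-n11-w5 g2's `…GaugeROfHcubeOmega` §1 (= B′'s `Record12BgRowCoClassGauge.bgRowAtDatumU_of_classBoundsPos_of_localGauge` :291 with (C1)∕(C2) replaced by their one use, the (1.12)-cube
inclusion) with that inclusion SUPPLIED by dag-n11-w4's `hcubeΩ_of_powM` from `0 < M`, `M = F.L ^ a` and (C1) `R_j = L·t_j` (compatible-or-one-block); the torus is read through it and the
no-wrap letter `hsN` only.  Proof: `have hcube := hcubeΩ_of_powM …`, then §1's text verbatim.  A REDUCTION; nothing of Bałaban asserted.
[cite: Balaban1988Convergent, (2.1) p.254, (2.27)–(2.28) p.259, (2.34)–(2.41) p.261, p.257; Balaban1987RG1, (1.11)–(1.16) p.262; Balaban1985Variational, Thm 1 (9) p.279] -/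
theorem bgRowAtDatumU_of_classBoundsPos_of_localGauge_of_powM (S : Sect2.Setting (MatA N) (SU N)) (hι : S.ι = ιSU N) (h𝓜 : S.𝓜 = B12RegularSpaces111SpecialUnitary.suModel N)
    (hS : S.Laws) (hpos : S.Pos) (ν : Stage7Numerics) {M : ℕ} (K k : ℕ) {b t : ℕ → ℝ}
    (s : SeqOfRecord F ν M S.flow.g K k) (U : GaugeField (F.P K) 0 (SU N))
    (hM : 0 < M) {a : ℕ} (hMa : M = F.L ^ a) (hC1 : ∀ j, 1 ≤ j → j ≤ k → ∃ t : ℕ, 0 < t ∧ RkOfRecord (F.P K).L ν.r (S.flow.g j) = (F.P K).L * t)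
    (hclass : ∀ n, 1 ≤ n → n ≤ k → PlaqSmallOn (omegaPlaqs s.Ω n) (b n * (F.P K).eta n ^ 2) (U))
    (hα : ∀ n, 1 ≤ n → n ≤ k → 0 < S.lf.alpha0 (S.flow.g n) ∧ 0 < S.lf.alpha1 (S.flow.g n))
    (hbα : ∀ n, 1 ≤ n → n ≤ k → b n ≤ (1 - S.βc) * S.lf.alpha0 (S.flow.g n))
    (htI : ∀ n, 1 ≤ n → n ≤ k → t n ≤ S.cB * S.lf.alpha0 (S.flow.g n))
    (htMS : ∀ n, 1 ≤ n → n ≤ k → t n ≤ S.B * S.C * S.Mr * S.lf.alpha0 (S.flow.g n))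
    (hgMS : ∀ n, 1 ≤ n → n ≤ k → ∀ a ∈ cubeIndices (F.P K) (B14.Eq213MaximalDomains.side (F.P K).L M n),
      cubeEnl (F.P K) (B14.Eq213MaximalDomains.side (F.P K).L M n) a 0 ⊆ s.Ω n →
      Sect2.LocalGaugeOn (cubeEnl (F.P K) (B14.Eq213MaximalDomains.side (F.P K).L M n) a 0) ((F.P K).eta n) (t n) U)
    (hgI : ∀ n, 1 ≤ n → n ≤ k → ∀ a ∈ cubeIndices (F.P K) (B14.Eq213MaximalDomains.side (F.P K).L M (n + 1)),
      cubeEnl (F.P K) (B14.Eq213MaximalDomains.side (F.P K).L M (n + 1)) a 0 ⊆ s.Ω n →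
      Sect2.LocalGaugeOn (cubeEnl (F.P K) (B14.Eq213MaximalDomains.side (F.P K).L M (n + 1)) a 0) ((F.P K).eta n) (t n) U) :
    ∀ j, 1 ≤ j → j ≤ k → ∀ X : (Sect2.domSys (F.P K) M j).Dom,
      (Sect2.domSites (F.P K) M j X ⊆ s.Λ j →
        Sect2.ofBackgroundC S.ι (U) ∈
          Sect2.spaceI S (Sect2.Residual.unit (F.P K) (MatA N)) M j (Sect2.domSites (F.P K) M j X) (S.lf.alpha0 (S.flow.g j)) (S.lf.alpha1 (S.flow.g j))) ∧
      (Sect2.admB (F.P K) ν M S.flow.g s.Ω s.Λ j (Sect2.domSites (F.P K) M j X) = true →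
        Sect2.ofBackgroundC S.ι (U) ∈
          Sect2.spaceMS S (Sect2.Residual.unit (F.P K) (MatA N)) M j (Sect2.domSites (F.P K) M j X) s.Ω) := by
  have hcube := hcubeΩ_of_powM ν hM hMa S.flow.g K k s hC1
  intro j h1 hjk X
  have hbα' : ∀ n, 1 ≤ n → n ≤ k → b n ≤ S.lf.alpha0 (S.flow.g n) := by
    intro n hn1 hnk
    refine (hbα n hn1 hnk).trans ?_
    have h0 := (hα n hn1 hnk).1.le
    nlinarith [hpos.βc_nonneg, h0]
  refine ⟨fun hX => ?_, fun _ => ?_⟩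
  · -- the `U^c_j` conjunct: class bound at scale `j` for (1.11), the handed-over gauges on the (1.12) cubes (in `Ω_j` by compatibility)
    have hcubeΩ := hcube j h1 hjk X hX
    have hloc : ∀ C ∈ Sect2.cubesI M j (Sect2.domSites (F.P K) M j X), ∃ u : Site (F.P K) 0 → (MatA N)ˣ, (∀ x, u x ∈ S.𝓜.G) ∧ ∃ A : PBond (F.P K) 0 → MatA N,
          (∀ bd ∈ C.bonds, gaugeU u (fun b' => S.ι (U b')) bd = expI ((F.P K).eta j) (A bd)) ∧
          (∀ bd ∈ C.bonds, ‖A bd‖ < S.cB * S.lf.alpha0 (S.flow.g j)) ∧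
          ∀ q ∈ C.dpairs, ‖grad ((F.P K).eta j) q.2.1 (fun y => A ⟨y, q.2.2⟩) q.1‖ < S.cB * S.lf.alpha0 (S.flow.g j) := by
      simp only [hι, h𝓜]
      exact localGauge_cubesI_of_localGaugeOn hcubeΩ (htI j h1 hjk) (hgI j h1 hjk)
    exact ofBackgroundC_mem_spaceI_of_classBoundU S hι hS ν M S.flow.g K k s U h1 hjk (hα j h1 hjk).1 (hα j h1 hjk).2 X hX
      (hbα' j h1 hjk) (hclass j h1 hjk) hloc
  · -- the `Ũ^c_j` conjunct: class bounds at the scales `1 ≤ n ≤ j` for (2.34), the handed-over gauges on the (2.38) cubes, rescaled to `ξ = η_j`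
    have h238 : CondII238 S.𝓜 (Sect2.frameMS (Sect2.Residual.unit (F.P K) (MatA N)) M j (Sect2.domSites (F.P K) M j X) s.Ω)
          (MSConsts.ofParams (F.P K) S.βc S.B S.C S.Mr j) (fun n => S.lf.alpha0 (S.flow.g n)) (fun b' => S.ι (U b')) := by
      simp only [hι, h𝓜]
      refine condII238_cubesMS_of_localGaugeOn (fun n hn1 hnj => ?_) (fun n hn1 hnj a ha _ hΩ => hgMS n hn1 (hnj.trans hjk) a ha hΩ)
      unfold rad238
      exact htMS n hn1 (hnj.trans hjk)
    exact ofBackgroundC_mem_spaceMS_of_classBoundU S hι hS hpos ν M K k s U (fun n hn1 hnj => hα n hn1 (hnj.trans hjk)) X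
      (fun n hn1 hnj => hbα n hn1 (hnj.trans hjk)) (fun n hn1 hnj => hclass n hn1 (hnj.trans hjk)) h238

/-- **§2 ★★ THE `(Adm, bd, Dat)`-GENERIC ᴮ ROW BODY FOR EVERY `bd`-MINIMISER `U₀` OVER THE TOP-DOMAIN CLASS (6), powM FORM**: dag-n11-d g41's `…GaugeROfHcubeOmega` §7.1 (rows `hadm`,
`h7 : Dat …`, `IsMinimizerB … (bd K k s.Ω) W U₀`; S1a-C `plaqSmallOn_of_thm1RegSepTop7MGB` + S1b-2 `localGaugeOn_of_thm1GaugeRegSepTop7MGB` into §1) with `hcube` replaced by `0 < M`, `M = F.L ^ a`,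
(C1).  The two ᴮ sentences are named facts, never asserted. [cite: Balaban1985Variational, Thm 1 (2),(6)–(9) pp.278–279, p.304 lines 1–2; Balaban1984PropagatorsII, (2.3) p.224; Balaban1988Convergent, (2.1) p.254, (2.12)–(2.13) p.256, (2.27)–(2.28) p.259, (2.34)–(2.41) p.261; Balaban1987RG1, (1.11)–(1.16) p.262] -/
theorem bgRowAtDatumU_of_thm1RegSepTop7MGB_of_thm1GaugeGB_of_powM {Sup : (ν : Stage7Numerics) → (K : ℕ) → (ℕ → Set (Site (F.P K) 0)) → Set (Site (F.P K) 0)} {M : ℕ}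
    {Adm : StepGuard F} {bd : BondDatum F} {Dat : TopData F N} {B₃ B₃' a₀ a₁ : ℝ} (h15 : VariationalThm1RegSepTop7MGB F N Sup Adm bd Dat B₃ a₀ a₁)
    (h15G : VariationalThm1GaugeRegSepTop7MGB F N Sup M Adm bd Dat B₃ B₃' a₀ a₁)
    (S : Sect2.Setting (MatA N) (SU N)) (hι : S.ι = ιSU N) (h𝓜 : S.𝓜 = B12RegularSpaces111SpecialUnitary.suModel N) (hS : S.Laws) (hpos : S.Pos)
    (ν : Stage7Numerics) (K k : ℕ) (cR : ℝ)
    (hnum : ∀ n, n ≤ k → 0 < cR * epsOfRecord ν S.flow.g n ∧ cR * epsOfRecord ν S.flow.g n ≤ a₁ ∧ B₃ * (cR * epsOfRecord ν S.flow.g n) ≤ ν.εreg)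
    (ha₀ : ν.εreg ≤ a₀) (hcomp : ∀ n, n < k → cR * epsOfRecord ν S.flow.g n ≤ 2 * (cR * epsOfRecord ν S.flow.g (n + 1)))
    (hcomp' : ∀ n, n < k → cR * epsOfRecord ν S.flow.g (n + 1) ≤ 2 * (cR * epsOfRecord ν S.flow.g n))
    (hα : ∀ n, 1 ≤ n → n ≤ k → 0 < S.lf.alpha0 (S.flow.g n) ∧ 0 < S.lf.alpha1 (S.flow.g n))
    (hBα : ∀ n, 1 ≤ n → n ≤ k → B₃ * (cR * epsOfRecord ν S.flow.g n) ≤ (1 - S.βc) * S.lf.alpha0 (S.flow.g n))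
    (htI : ∀ n, 1 ≤ n → n ≤ k → B₃' * (cR * epsOfRecord ν S.flow.g n) ≤ S.cB * S.lf.alpha0 (S.flow.g n))
    (htMS : ∀ n, 1 ≤ n → n ≤ k → B₃' * (cR * epsOfRecord ν S.flow.g n) ≤ S.B * S.C * S.Mr * S.lf.alpha0 (S.flow.g n))
    (hsN : ∀ n, 1 ≤ n → n ≤ k + 1 → ((B14.Eq213MaximalDomains.side (F.P K).L M n : ℕ) : ℤ) < (F.P K).sitesPerDir 0)
    (s : SeqOfRecord F ν M S.flow.g K k) (hsep : Sect2.SeqSeparated ν.M₁ s) (hM₁ : 0 < ν.M₁) (hadm : Adm ν M S.flow.g K k s) {W : MSField (F.P K) (SU N)}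
    (hM : 0 < M) {a : ℕ} (hMa : M = F.L ^ a) (hC1 : ∀ j, 1 ≤ j → j ≤ k → ∃ t : ℕ, 0 < t ∧ RkOfRecord (F.P K).L ν.r (S.flow.g j) = (F.P K).L * t)
    (h7 : Dat K s.Ω (Sup ν K s.Ω) k (fun n => cR * epsOfRecord ν S.flow.g n) W)
    {U₀ : GaugeField (F.P K) 0 (SU N)} (hmin : IsMinimizerB (avOfRecord F N K)
      {U | (∀ n, n ≤ k → PlaqSmallOn (Sect2.omegaPlaqsTop s.Ω (Sup ν K s.Ω) n) (ν.εreg * (F.P K).eta n ^ 2) U) ∧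
        Sect2.CoDivClassOnTop s.Ω (Sup ν K s.Ω) k ν.εreg U} (bd K k s.Ω) W U₀) :
    ∀ j, 1 ≤ j → j ≤ k → ∀ X : (Sect2.domSys (F.P K) M j).Dom,
      (Sect2.domSites (F.P K) M j X ⊆ s.Λ j →
        Sect2.ofBackgroundC S.ι (U₀) ∈
          Sect2.spaceI S (Sect2.Residual.unit (F.P K) (MatA N)) M j (Sect2.domSites (F.P K) M j X) (S.lf.alpha0 (S.flow.g j)) (S.lf.alpha1 (S.flow.g j))) ∧
      (Sect2.admB (F.P K) ν M S.flow.g s.Ω s.Λ j (Sect2.domSites (F.P K) M j X) = true →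
        Sect2.ofBackgroundC S.ι (U₀) ∈
          Sect2.spaceMS S (Sect2.Residual.unit (F.P K) (MatA N)) M j (Sect2.domSites (F.P K) M j X) s.Ω) := by
  have hplaq := plaqSmallOn_of_thm1RegSepTop7MGB h15 ν M S.flow.g K k cR s hsep hM₁ hadm hnum ha₀ hcomp hcomp' h7 hmin
  have hclass : ∀ n, 1 ≤ n → n ≤ k → PlaqSmallOn (omegaPlaqs s.Ω n) (B₃ * (cR * epsOfRecord ν S.flow.g n) * (F.P K).eta n ^ 2) U₀ := by
    intro n hn1 hnk
    have := hplaq n hnk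
    rwa [Sect2.omegaPlaqsTop_of_ne_zero _ _ (Nat.one_le_iff_ne_zero.mp hn1)] at this
  have hg := localGaugeOn_of_thm1GaugeRegSepTop7MGB h15G ν S.flow.g K k cR s hsep hM₁ hadm hnum ha₀ hcomp hcomp' h7 hmin
  exact bgRowAtDatumU_of_classBoundsPos_of_localGauge_of_powM S hι h𝓜 hS hpos ν K k s U₀ hM hMa hC1 hclass hα hBα htI htMS
    (fun n hn1 hnk => (hg n hn1 hnk).1 (hsN n hn1 (by omega))) (fun n hn1 hnk => (hg n hn1 hnk).2 (hsN (n + 1) (by omega) (by omega)))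

/-- **§3 ★★★ THE BACKGROUND-GENERIC STAGE-13 LIFT, NO RUN GUARD, powM FORM** — dag-n11-d g41's `…GaugeROfHcubeOmega` §7.3 (the ᴮ sentences `VariationalThm1RegSepCoP7MGB F N Adm bd Dat` ∕
`VariationalThm1GaugeRegSepCoP7MGB F N θ.τ9.M Adm bd Dat`; the background a PARAMETER `Ubg` entering only through its per-prefix `bd`-spec dichotomy `hbg`; guard `Adm` as an inner antecedent;
`hsN` displayed) with the run-indexed cube inclusion REPLACED by `hMa : θ.τ9.M = F.L ^ a` and the window-run-indexed (C1) letter `hC1` — exactly the form `…N11BgRowGaugeSocketsGB` §1a reads.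
TODAY `(Ubg, bd, hbg) := (UbgMSCoPOfRecord, genSetDatum F, ubgMSCoPOfRecord_dichotomy_genSetDatum)`; after the Stage-2 seam `(UbgMSCoPOfRecordB, lamDatum F, ubgMSCoPOfRecordB_dichotomy)`.  A REDUCTION;
nothing of Bałaban asserted. [cite: Balaban1985Variational, (6)–(7) p.278, Thm 1 (8)–(9) p.279, Prop. 8 p.304; Balaban1984PropagatorsII, (2.3) p.224; Balaban1988Convergent, Thm 1 p.262, (2.1) p.254, (2.5) p.255, (2.12)–(2.13) p.256; Balaban1987RG1, (0.1) p.251, (1.11)–(1.12) p.262] -/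
theorem stage13_bgAtDatumBg_of_thm1RegSepCoP7MGB_of_thm1GaugeGB_of_powM (θ : Stage13Params F N) (hθ : θ.Admissible F N) (hRz : θ.Rz = RzOfRecord F N)
    {Adm : StepGuard F} {bd : BondDatum F} {Dat : TopData F N} {B₃ B₃' a₀ a₁ : ℝ}
    (h15 : VariationalThm1RegSepCoP7MGB F N Adm bd Dat B₃ a₀ a₁) (h15G : VariationalThm1GaugeRegSepCoP7MGB F N θ.τ9.M Adm bd Dat B₃ B₃' a₀ a₁)
    (Ubg : (p : B12.RunParams) → (n : ℕ) → SeqOfRecord F θ.ν θ.τ9.M (gOfRecord₁₃ F N θ p) p.K n → MSField (F.P p.K) (SU N) → GaugeField (F.P p.K) 0 (SU N))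
    (hbg : ∀ (p : B12.RunParams) (n : ℕ) (s : SeqOfRecord F θ.ν θ.τ9.M (gOfRecord₁₃ F N θ p) p.K n) (W : MSField (F.P p.K) (SU N)),
      IsMinimizerB (avOfRecord F N p.K) (regMSCoPOfRecord F N θ.ν p.K n s.Ω) (bd p.K n s.Ω) W (Ubg p n s W) ∨ Ubg p n s W = 1)
    (hnum : ∀ (p : B12.RunParams) (n : ℕ), n ≤ p.K → Step.InInterval θ.γ n (gOfRecord₁₃ F N θ p) → ∀ m, m ≤ n →
      0 < θ.s2.cR * epsOfRecord θ.ν (gOfRecord₁₃ F N θ p) m ∧ θ.s2.cR * epsOfRecord θ.ν (gOfRecord₁₃ F N θ p) m ≤ a₁ ∧ B₃ * (θ.s2.cR * epsOfRecord θ.ν (gOfRecord₁₃ F N θ p) m) ≤ θ.ν.εreg)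
    (ha₀ : θ.ν.εreg ≤ a₀)
    (hcomp : ∀ (p : B12.RunParams) (n : ℕ), n ≤ p.K → Step.InInterval θ.γ n (gOfRecord₁₃ F N θ p) → ∀ m, m < n →
      θ.s2.cR * epsOfRecord θ.ν (gOfRecord₁₃ F N θ p) m ≤ 2 * (θ.s2.cR * epsOfRecord θ.ν (gOfRecord₁₃ F N θ p) (m + 1)))
    (hcomp' : ∀ (p : B12.RunParams) (n : ℕ), n ≤ p.K → Step.InInterval θ.γ n (gOfRecord₁₃ F N θ p) → ∀ m, m < n →
      θ.s2.cR * epsOfRecord θ.ν (gOfRecord₁₃ F N θ p) (m + 1) ≤ 2 * (θ.s2.cR * epsOfRecord θ.ν (gOfRecord₁₃ F N θ p) m))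
    (hBα : ∀ (p : B12.RunParams) (n : ℕ), n ≤ p.K → Step.InInterval θ.γ n (gOfRecord₁₃ F N θ p) → ∀ m, 1 ≤ m → m ≤ n →
      B₃ * (θ.s2.cR * epsOfRecord θ.ν (gOfRecord₁₃ F N θ p) m) ≤ (1 - θ.s2.βc) * (lfOfRecord₁₂ F N θ.toStage12Params).alpha0 (gOfRecord₁₃ F N θ p m))
    (htI : ∀ (p : B12.RunParams) (n : ℕ), n ≤ p.K → Step.InInterval θ.γ n (gOfRecord₁₃ F N θ p) → ∀ m, 1 ≤ m → m ≤ n →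
      B₃' * (θ.s2.cR * epsOfRecord θ.ν (gOfRecord₁₃ F N θ p) m) ≤ θ.s2.cB * (lfOfRecord₁₂ F N θ.toStage12Params).alpha0 (gOfRecord₁₃ F N θ p m))
    (htMS : ∀ (p : B12.RunParams) (n : ℕ), n ≤ p.K → Step.InInterval θ.γ n (gOfRecord₁₃ F N θ p) → ∀ m, 1 ≤ m → m ≤ n →
      B₃' * (θ.s2.cR * epsOfRecord θ.ν (gOfRecord₁₃ F N θ p) m) ≤ θ.s2.B * θ.s2.C * θ.s2.Mr * (lfOfRecord₁₂ F N θ.toStage12Params).alpha0 (gOfRecord₁₃ F N θ p m))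
    {a : ℕ} (hMa : θ.τ9.M = F.L ^ a)
    (hC1 : ∀ (p : B12.RunParams) (n : ℕ), n ≤ p.K → Step.InInterval θ.γ n (gOfRecord₁₃ F N θ p) → ∀ j, 1 ≤ j → j ≤ n →
      ∃ t : ℕ, 0 < t ∧ RkOfRecord (F.P p.K).L θ.ν.r (gOfRecord₁₃ F N θ p j) = (F.P p.K).L * t)
    (hsN : ∀ (p : B12.RunParams) (n : ℕ), n ≤ p.K → ∀ n', 1 ≤ n' → n' ≤ n + 1 →
      ((B14.Eq213MaximalDomains.side (F.P p.K).L θ.τ9.M n' : ℕ) : ℤ) < (F.P p.K).sitesPerDir 0) :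
    ∀ (p : B12.RunParams) (n : ℕ), n ≤ p.K → Step.InInterval θ.γ n (gOfRecord₁₃ F N θ p) →
      ∀ s : SeqOfRecord F θ.ν θ.τ9.M (gOfRecord₁₃ F N θ p) p.K n, Sect2.SeqSeparated θ.ν.M₁ s → 0 < θ.ν.M₁ →
      Adm θ.ν θ.τ9.M (gOfRecord₁₃ F N θ p) p.K n s → ∀ W : MSField (F.P p.K) (SU N),
      Dat p.K s.Ω (suppDomOfRecord F θ.ν p.K s.Ω) n (fun j => θ.s2.cR * epsOfRecord θ.ν (gOfRecord₁₃ F N θ p) j) W →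
      ∀ j, 1 ≤ j → j ≤ n → ∀ X : (Sect2.domSys (F.P p.K) θ.τ9.M j).Dom,
      (Sect2.domSites (F.P p.K) θ.τ9.M j X ⊆ s.Λ j →
        Sect2.ofBackgroundC (settingOfRecord₁₃ F N θ p).ι (Ubg p n s W) ∈
          Sect2.spaceI (settingOfRecord₁₃ F N θ p) (θ.Rz p.K) θ.τ9.M j (Sect2.domSites (F.P p.K) θ.τ9.M j X)
            ((settingOfRecord₁₃ F N θ p).lf.alpha0 ((settingOfRecord₁₃ F N θ p).flow.g j)) ((settingOfRecord₁₃ F N θ p).lf.alpha1 ((settingOfRecord₁₃ F N θ p).flow.g j))) ∧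
      (Sect2.admB (F.P p.K) θ.ν θ.τ9.M (gOfRecord₁₃ F N θ p) s.Ω s.Λ j (Sect2.domSites (F.P p.K) θ.τ9.M j X) = true →
        Sect2.ofBackgroundC (settingOfRecord₁₃ F N θ p).ι (Ubg p n s W) ∈
          Sect2.spaceMS (settingOfRecord₁₃ F N θ p) (θ.Rz p.K) θ.τ9.M j (Sect2.domSites (F.P p.K) θ.τ9.M j X) s.Ω) := by
  intro p n hn hw s hsep hM₁ hadm W h7
  have hM : 0 < θ.τ9.M := by rw [hMa]; have := F.hL11; positivity
  rw [hRz]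
  rcases hbg p n s W with hmin | h1
  · exact bgRowAtDatumU_of_thm1RegSepTop7MGB_of_thm1GaugeGB_of_powM h15 h15G (settingOfRecord₁₃ F N θ p) rfl rfl (settingOfRecord₁₃_laws F N θ p)
      (settingOfRecord₁₃_pos F N θ hθ.1.pos p) θ.ν p.K n θ.s2.cR (hnum p n hn hw) ha₀ (hcomp p n hn hw) (hcomp' p n hn hw)
      (fun m _ hm => alphaPos₁₃_of_inInterval hθ hw hm) (hBα p n hn hw) (htI p n hn hw) (htMS p n hn hw) (hsN p n hn) s hsep hM₁ hadm hM hMa (hC1 p n hn hw) h7 hmin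
  · rw [h1]
    exact bgRowAtDatum_one (settingOfRecord₁₃ F N θ p) (settingOfRecord₁₃_pos F N θ hθ.1.pos p) θ.ν θ.τ9.M p.K n s
      (fun m _ hm => alphaPos₁₃_of_inInterval hθ hw hm)

end Summit.QuantumFields.YangMills.Theorems.BalabanUVNodesN11BgRowGaugeLiftOfPowM

end
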